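import Summits.HodgeConjecture.HodgeConjecture.Theorems.F0D6CmCurveBodyAJunction   -- ★ previous part of the same Lines workfile `D6CmCurveBodyA` (size-lint split ×5)
import HarnessLib

/-!
# `F0D6CmCurveBodyASockets` — ★ RE-HOME of `Lines/D6CmCurveBodyA.lean`, PART 4 of 5 (size-lint split; cut at a top-level declaration boundary).

See PART 1 `Theorems/F0D6CmCurveBodyAGlue.lean` for the full re-home header and the original module docstring (verbatim there). Namespaces KEPT
(re-opened below exactly as they stand at the cut, with their `open` lines); code bytes = the workfile՚s, docstrings included; options preamble repeated from PART 1.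
HC_CM is proved only modulo the 7 printed citations (2 remaining: hLiu418 = stmt-HodgeConjecture-24832, h413 = stmt-HodgeConjecture-24833) until rung 0 closes; a re-home is count-neutral. -/

noncomputable section

open scoped TensorProduct NumberField
open NumberField IsDedekindDomain Filter
open Literature.NumberTheory.GaloisRepresentations
open Literature.NumberTheory.Automorphic
open Literature.NumberTheory.Automorphic.Liu2021.AppendixC
open scoped TensorProduct Matrix NumberField Kronecker ComplexOrder
open NumberField NumberField.InfinitePlace IsDedekindDomain
open Summit.HodgeConjecture.CorCM.Model Summit.HodgeConjecture.CorCM.Model.HComp Summit.HodgeConjecture.CorCM.HComp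
open Literature.AlgebraicGeometry.Motives (CMType)
open Literature.AlgebraicGeometry.ShimuraVarieties.UnitaryCanonicalModel
open Literature.NumberTheory.Automorphic Literature.NumberTheory.Automorphic.UnitaryGroup
open Literature.NumberTheory.Automorphic.IdeleClassGroup Literature.NumberTheory.Automorphic.Liu2021 Literature.NumberTheory.Automorphic.Liu2021.AppendixC
open Literature.NumberTheory.GaloisRepresentations Literature.RepresentationTheory.Liu2021 Literature.RepresentationTheory.HarrisKudlaSweet1996
open Literature.AlgebraicGeometry.Liu2021 (IsAdmissibleElement)
open Literature.NumberTheory.Weil1964 Literature.NumberTheory.GelbartRogawski1991 Literature.NumberTheory.GelbartRogawski1991.UnitaryDualPair Literature.NumberTheory.GelbartRogawski1991.UnitaryDualPair.WeilCoinv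
open Literature.NumberTheory.GelbartRogawski1991.UnitaryDualPair.LocalSplitting
open Literature.NumberTheory.Automorphic.Liu2021.Def411WeilCarriersDoubling
open Literature.NumberTheory.Automorphic.Liu2021.Def411WeilCarriers (TW JW JW_eq isSymm_TW isUnit_det_TW Rep Eps epsOf Chi rhoVAtLine)

namespace Summit.HodgeConjecture.CorCM.Lines.A3Liu418
open D6Glue
open CategoryTheory
open Literature.AlgebraicGeometry.Motives (AbelianVariety)

/-! ## Part D — discharging the two auxiliary shapes: `SMShape` (★ `rhoAtLine_smooth`) and `JstarShape` (from `hg`) -/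

/-- **`SMShape` HOLDS** — smoothness of the registered `ω⋆_lab`: ★ `Def411WeilCarriers.rhoAtLine_smooth` with
`ι := (finAdelicCongr … gstar ht hg).symm`, `hsc := hscChiGS …` (★ `WeilCoinv.weilCoinv_comp_smooth` underneath). -/
theorem smShape_holds : SMShape := by
  intro F _ ι₁ μ hμ hw ℓ _ ι' Jstar t ht hτt hτt' gstar dJ hdJ hdJ0 hg hsig K₀ S hU7ₛ hLQ h4 isoₛ r ε hadm χ x
  exact Def411WeilCarriers.rhoAtLine_smooth ↥(maximalRealSubfield (F : Type)) (F : Type) (IsCMField.complexConj (F : Type)) 2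
    (finProdFinEquiv : Fin 2 × Fin 1 ≃ Fin (2 * 1)) (Matrix.diagonal dJ)
    (complexConj_imagUnit F) (imagUnit_ne_zero F) (imagUnit_mul_self F) (realDiagonal_isSymm F dJ hdJ)
    (isUnit_det_realDiagonal F dJ hdJ hdJ0) (realDiagonal_map F dJ hdJ).symm
    (hsChiGS F finProdFinEquiv dJ hdJ hdJ0
      (toHeckeCharacter (F : Type) (galConj (IsCMField.complexConj (F : Type)) μ))
      (isUnitary_toHeckeCharacter (F : Type) (galConj (IsCMField.complexConj (F : Type)) μ))
      ((isOscillatorChar_toHeckeCharacter_iff (galConj (IsCMField.complexConj (F : Type)) μ)).mpr hμ.galConj))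
    (finAdelicCongr ↥(maximalRealSubfield (F : Type)) (F : Type) (IsCMField.complexConj (F : Type)) gstar ht hg).symm.toMonoidHom
    (finAdelicCongr ↥(maximalRealSubfield (F : Type)) (F : Type) (IsCMField.complexConj (F : Type)) gstar ht hg).symm.continuous
    (fun a => hscChiGS F finProdFinEquiv dJ hdJ hdJ0
      (toHeckeCharacter (F : Type) (galConj (IsCMField.complexConj (F : Type)) μ))
      (isUnitary_toHeckeCharacter (F : Type) (galConj (IsCMField.complexConj (F : Type)) μ))
      ((isOscillatorChar_toHeckeCharacter_iff (galConj (IsCMField.complexConj (F : Type)) μ)).mpr hμ.galConj) a)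
    (r.toFun ε) χ x

/-- `formCongr` by an involution preserves hermitian matrices: `ᵗσ(ᵗσT · H · T) = ᵗσT · H · T` when `ᵗσH = H`, `σ ∘ σ = id`.
[folklore] -/
theorem conjTranspose_formCongr_of_involutive {R : Type*} [CommRing R] {n : Type*} [Fintype n] [DecidableEq n]
    (σ : R →+* R) (hσ : ∀ x, σ (σ x) = x) (T : GL n R) (H : Matrix n n R) (hH : (H.map σ)ᵀ = H) :
    ((formCongr σ T H).map σ)ᵀ = formCongr σ T H := by
  have hTT : ((T : Matrix n n R).map σ).map σ = (T : Matrix n n R) := by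
    ext i j; simp [hσ]
  simp only [formCongr, Matrix.map_mul, Matrix.transpose_mul, Matrix.transpose_map, hTT, Matrix.transpose_transpose,
    Matrix.mul_assoc]
  rw [← Matrix.transpose_map, hH]

/-- **`JstarShape` HOLDS** — `ᵗ(cJ⋆) = J⋆` and `J⋆ ∈ GL₂(F)` from the registered frame `hg : ᵗ(c g⋆)(t • J⋆)g⋆ = diag dJ` with
`dJ` real non-zero and `t` real at `ι₁` (hence `c t = t`, `t ≠ 0`). -/
theorem jstarShape_holds : JstarShape := by
  intro F _ ι₁ μ hμ hw ℓ _ ι' Jstar t ht hτt hτt' gstar dJ hdJ hdJ0 hg hsig K₀ S hU7ₛ hLQ h4 isoₛ r ε hadm χ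
  -- `c t = t`: `ι₁ (c t) = conj (ι₁ t) = ι₁ t`
  have hct : (IsCMField.complexConj (F : Type)) t = t := by
    apply ι₁.injective
    rw [IsCMField.complexEmbedding_complexConj]
    exact Complex.conj_eq_iff_im.mpr hτt'
  -- the diagonal is hermitian and invertible
  have hD : ((Matrix.diagonal dJ).map ((IsCMField.complexConj (F : Type)) : (F : Type) →+* (F : Type)))ᵀ = Matrix.diagonal dJ := by
    rw [Matrix.diagonal_map (map_zero _), Matrix.diagonal_transpose]
    exact congrArg Matrix.diagonal (funext hdJ)
  -- `t • J⋆ = formCongr c g⋆⁻¹ (diag dJ)` is hermitian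
  have htJ : t • Jstar = formCongr ((IsCMField.complexConj (F : Type)) : (F : Type) →+* (F : Type)) gstar⁻¹ (Matrix.diagonal dJ) := by
    rw [← hg, formCongr_inv_formCongr]
  have hherm_t : ((t • Jstar).map ((IsCMField.complexConj (F : Type)) : (F : Type) →+* (F : Type)))ᵀ = t • Jstar := by
    rw [htJ]
    exact conjTranspose_formCongr_of_involutive _ (IsCMField.complexConj_apply_apply (F : Type)) _ _ hD
  have hherm : (Jstar.map (IsCMField.complexConj (F : Type)))ᵀ = Jstar := by
    have h1 : ((t • Jstar).map ((IsCMField.complexConj (F : Type)) : (F : Type) →+* (F : Type)))ᵀ = t • (Jstar.map (IsCMField.complexConj (F : Type)))ᵀ := by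
      rw [Matrix.map_smul' _ _ _ (map_mul _), Matrix.transpose_smul]
      congr 1
    rw [h1] at hherm_t
    exact smul_right_injective _ ht hherm_t
  refine ⟨hherm, ?_⟩
  -- invertibility: `det (diag dJ) ≠ 0`
  have hdet : IsUnit (Matrix.diagonal dJ).det := by
    rw [Matrix.det_diagonal, isUnit_iff_ne_zero]
    exact Finset.prod_ne_zero_iff.mpr fun i _ => hdJ0 i
  rw [← hg] at hdet
  simp only [formCongr, Matrix.det_mul, Matrix.det_smul, IsUnit.mul_iff] at hdet
  exact (Matrix.isUnit_iff_isUnit_det _).mpr hdet.1.2.2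

/-- **THE HEAD, FINAL SHAPE (WORLD M)**: the REGISTERED `thmD6OneCurveCUF` from the two theorem-sockets S1′ (`SocketS1`), S2 (`SocketS2`) and the two
FACT shapes `S3ShapeM`, `S4ShapeA` (D2/D3 by name) — smoothness and the frame facts discharged in-file. -/
theorem thmD6OneCurveCUF_M_of_S1_S2_S3_S4 (h1 : SocketS1) (h2 : SocketS2) (h3 : S3ShapeM) (h4 : S4ShapeA) :
    thmD6OneCurveCUF :=
  thmD6OneCurveCUF_M_of_shapes h1 h2 jstarShape_holds smShape_holds h3 h4

/-! ## Part E — `SocketS2` from S2′ (A-p03 (g10) (J3) §2, guarded) and the (J2)-conjunct shape, by ONE call of ★ p739802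

`S2primeShape` = THE theorem of the d6 line ([Liu2021, App. D §D.4 l. 5626–5628] «the `ω⋆_lab`-isotypic quotient of the Albanese
carries a rational CM structure of full degree and one non-zero eigen-class of the block»), in the binders of A-p03 (g10)՚s audit §2
(levers ★ p741690 `EtaleH1TowerHeckeEndomorphism` → ★ p740255 `AbelianVarietyQuasiIdempotentImageDual` named only), GUARDED by
«the block is non-zero» (A-plan2 (g11) 20:13:14Z (iii)).  `J2Shape` = the ONE orientation conjunct the composition consumes: for the data
S2′ provides and ANY CM-type realisation of the quotient that ★ p739802 may return, the FIRST exponent of the Shimura–Taniyama type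
`cmInfinityType Φ.1 τ ι₁` at `w₁ = mk ι₁` is `μ^{alg}`՚s, `(1 − e(w₁))/2` (producer: A-p11 (g11) (b) over ★ p742202 + S1 clause (2)).
`socketS2_of_S2prime`: one call of ★ `Sec42Data.exists_heckeCharacter_towerRep_eq_inv_smul_of_ringHom′` with `R := ℚ̄_ℓ`,
`ι' := (ι′ : ℂ →+* ℚ̄_ℓ)`, `[Algebra F ℂ] := ι₁.toAlgebra`, `B := image u`, `φ := toImage u`. -/

/-- **`S2primeShape`** — S2′ = `stub_d6_cmIsotypicQuotient` (A-p03 (g10) (J3) §2 text, guarded): if the block is non-zero, there are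
a level `K`, a quasi-idempotent `u` on the Albanese `A_K` (`u ≫ u = a • u`, `a ≠ 0`), a CM number field `M` acting RATIONALLY on
`Im u` with `[M:ℚ] = 2 dim (Im u)`, an embedding `τ : M → ℂ` and ONE `τ`-eigen class `f` of `ℚ̄_ℓ ⊗ V_ℓ(Im u)^∨` whose transport
`y := (toTower K ∘ ᵗV_ℓ(ū)) f` to `ℚ̄_ℓ ⊗ H¹_ét(A_∞)` is non-zero and lies in the span of the block. -/
def S2primeShape : Prop :=
  ∀ (F : CMField) [IsGalois ℚ F] (ι₁ : F →+* ℂ)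
    (μ : Literature.NumberTheory.Automorphic.IdeleClassGroup (F : Type) →ₜ* Circle)
    (hμ : IdeleClassGroup.IsConjugateSymplectic (F : Type) μ)
    (_hw : IdeleClassGroup.HasWeight (F : Type) μ 1)
    (ℓ : ℕ) [Fact ℓ.Prime] (ι' : ℂ ≃+* AlgebraicClosure ℚ_[ℓ])
    (Jstar : Matrix (Fin 2) (Fin 2) (F : Type)) (t : (F : Type)) (ht : t ≠ 0) (_hτt : 0 < (ι₁ t).re) (_hτt' : (ι₁ t).im = 0)
    (gstar : GL (Fin 2) (F : Type))
    (dJ : Fin 2 → (F : Type)) (hdJ : ∀ i, IsCMField.complexConj (F : Type) (dJ i) = dJ i) (hdJ0 : ∀ i, dJ i ≠ 0)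
    (hg : formCongr ((IsCMField.complexConj (F : Type) : (F : Type) ≃ₐ[↥(maximalRealSubfield (F : Type))] (F : Type)) :
        (F : Type) →+* (F : Type)) gstar (t • Jstar) = Matrix.diagonal dJ)
    (_hsig : (∃ Tstar : GL (Fin 2) ℂ,
        formCongr (starRingEnd ℂ) Tstar ((Matrix.diagonal dJ).map ι₁) = Matrix.diagonal ![(1 : ℂ), -1]) ∧
      ∀ τ' : (F : Type) →+* ℂ, InfinitePlace.mk τ' ≠ InfinitePlace.mk ι₁ → ((Matrix.diagonal dJ).map τ').PosDef)
    (K₀ : C5.OpenCompactSubgroup ↥(finAdelic ↥(maximalRealSubfield (F : Type)) (F : Type) (IsCMField.complexConj (F : Type)) 2 Jstar))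
    (S : RecordSystemGS (F : Type) Jstar ι₁ K₀) (hU7ₛ : S.HeckeTranslateDefinedOver) (hLQ : S.IsLevelQuotient)
    (h4 : 4 ≤ Module.finrank ℚ (F : Type)) (isoₛ : ℕ → Prop)
    (r : Rep ↥(maximalRealSubfield (F : Type)) (imagUnitSq F))
    (ε : Eps ↥(maximalRealSubfield (F : Type)) (imagUnitSq F))
    (_hadm : ∃ e : (F : Type), IsAdmissibleElement (F : Type) hμ.cmType.1 e ∧
      epsOf ↥(maximalRealSubfield (F : Type)) (imagUnitSq F) (F : Type) (2 * imagUnit (F : Type))⁻¹ (-e) = ε)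
    (χ : Chi ↥(maximalRealSubfield (F : Type)) (F : Type) (IsCMField.complexConj (F : Type))),
    (∃ f' ∈ (etaleHeckeDatumGS S hU7ₛ hLQ h4 isoₛ ℓ).omegaHom ι'
        ((rhoVAtLine ↥(maximalRealSubfield (F : Type)) (F : Type) (IsCMField.complexConj (F : Type)) 2
          (finProdFinEquiv : Fin 2 × Fin 1 ≃ Fin (2 * 1)) (Matrix.diagonal dJ)
          (complexConj_imagUnit F) (imagUnit_ne_zero F) (imagUnit_mul_self F) (realDiagonal_isSymm F dJ hdJ)
          (isUnit_det_realDiagonal F dJ hdJ hdJ0) (realDiagonal_map F dJ hdJ).symm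
          (hsChiGS F finProdFinEquiv dJ hdJ hdJ0
            (toHeckeCharacter (F : Type) (galConj (IsCMField.complexConj (F : Type)) μ))
            (isUnitary_toHeckeCharacter (F : Type) (galConj (IsCMField.complexConj (F : Type)) μ))
            ((isOscillatorChar_toHeckeCharacter_iff (galConj (IsCMField.complexConj (F : Type)) μ)).mpr hμ.galConj))
          (r.toFun ε) χ).comp
          (finAdelicCongr ↥(maximalRealSubfield (F : Type)) (F : Type) (IsCMField.complexConj (F : Type)) gstar ht hg).symm.toMonoidHom), ∃ w, f' w ≠ 0) →
    ∃ (K : C5.SmallLevel K₀) (u : (sec42DataGS S h4 isoₛ).A K ⟶ (sec42DataGS S h4 isoₛ).A K) (a : ℕ), a ≠ 0 ∧ u ≫ u = a • u ∧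
      ∃ (M : Type) (_ : Field M) (_ : NumberField M) (_ : IsCMField M)
        (i : M →+* (AbelianVariety.image u).endAlgebra),
        Module.finrank ℚ M = 2 * (AbelianVariety.image u).dim ∧
        ∃ (τ : M →+* ℂ) (f : (AlgebraicClosure ℚ_[ℓ]) ⊗[ℚ_[ℓ]] Module.Dual ℚ_[ℓ] ((AbelianVariety.image u).rationalTateModule ℓ)),
          (∀ m : M, ((AbelianVariety.rationalTateAction (AbelianVariety.image u) ℓ (i m)).dualMap).baseChange (AlgebraicClosure ℚ_[ℓ]) f =
            ι' (τ m) • f) ∧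
          (((sec42DataGS S h4 isoₛ).toTower ℓ K ∘ₗ (AbelianVariety.rationalTateModuleMap ℓ (AbelianVariety.toImage u)).dualMap).baseChange (AlgebraicClosure ℚ_[ℓ])) f ≠ 0 ∧
          (((sec42DataGS S h4 isoₛ).toTower ℓ K ∘ₗ (AbelianVariety.rationalTateModuleMap ℓ (AbelianVariety.toImage u)).dualMap).baseChange (AlgebraicClosure ℚ_[ℓ])) f ∈
            Submodule.span (AlgebraicClosure ℚ_[ℓ]) (blockValues (sec42DataGS S h4 isoₛ) ℓ (etaleHeckeDatumGS S hU7ₛ hLQ h4 isoₛ ℓ) ι'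
              ((rhoVAtLine ↥(maximalRealSubfield (F : Type)) (F : Type) (IsCMField.complexConj (F : Type)) 2
          (finProdFinEquiv : Fin 2 × Fin 1 ≃ Fin (2 * 1)) (Matrix.diagonal dJ)
          (complexConj_imagUnit F) (imagUnit_ne_zero F) (imagUnit_mul_self F) (realDiagonal_isSymm F dJ hdJ)
          (isUnit_det_realDiagonal F dJ hdJ hdJ0) (realDiagonal_map F dJ hdJ).symm
          (hsChiGS F finProdFinEquiv dJ hdJ hdJ0
            (toHeckeCharacter (F : Type) (galConj (IsCMField.complexConj (F : Type)) μ))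
            (isUnitary_toHeckeCharacter (F : Type) (galConj (IsCMField.complexConj (F : Type)) μ))
            ((isOscillatorChar_toHeckeCharacter_iff (galConj (IsCMField.complexConj (F : Type)) μ)).mpr hμ.galConj))
          (r.toFun ε) χ).comp
          (finAdelicCongr ↥(maximalRealSubfield (F : Type)) (F : Type) (IsCMField.complexConj (F : Type)) gstar ht hg).symm.toMonoidHom))

/-- **`J2Shape`** — the ONE orientation conjunct (producer: A-p11 (g11) (b) over (J2) ★ p742202 + S1 clause (2)): for a level `K`,
a quotient `φ : A_K → B`, a rational CM structure `i : M → End⁰(B)` of full degree, an embedding `τ` and a `τ`-eigen class `f` whose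
transport is a non-zero element of the span of the `ω⋆_lab`-block, and for EVERY CM-type realisation `(B′, u′, v′, m, ρ, Φ)` of it up to
isogeny (the data ★ p739802 returns): the first exponent of `cmInfinityType Φ.1 τ ι₁` at `w₁ = mk ι₁` is `(1 − e(w₁))/2`
(`e := hμ.infinityType`, ★ `hasInfinityType_muAlg`՚s first exponent). -/
def J2Shape : Prop :=
  ∀ (F : CMField) [IsGalois ℚ F] (ι₁ : F →+* ℂ)
    (μ : Literature.NumberTheory.Automorphic.IdeleClassGroup (F : Type) →ₜ* Circle)
    (hμ : IdeleClassGroup.IsConjugateSymplectic (F : Type) μ)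
    (_hw : IdeleClassGroup.HasWeight (F : Type) μ 1)
    (ℓ : ℕ) [Fact ℓ.Prime] (ι' : ℂ ≃+* AlgebraicClosure ℚ_[ℓ])
    (Jstar : Matrix (Fin 2) (Fin 2) (F : Type)) (t : (F : Type)) (ht : t ≠ 0) (_hτt : 0 < (ι₁ t).re) (_hτt' : (ι₁ t).im = 0)
    (gstar : GL (Fin 2) (F : Type))
    (dJ : Fin 2 → (F : Type)) (hdJ : ∀ i, IsCMField.complexConj (F : Type) (dJ i) = dJ i) (hdJ0 : ∀ i, dJ i ≠ 0)
    (hg : formCongr ((IsCMField.complexConj (F : Type) : (F : Type) ≃ₐ[↥(maximalRealSubfield (F : Type))] (F : Type)) :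
        (F : Type) →+* (F : Type)) gstar (t • Jstar) = Matrix.diagonal dJ)
    (_hsig : (∃ Tstar : GL (Fin 2) ℂ,
        formCongr (starRingEnd ℂ) Tstar ((Matrix.diagonal dJ).map ι₁) = Matrix.diagonal ![(1 : ℂ), -1]) ∧
      ∀ τ' : (F : Type) →+* ℂ, InfinitePlace.mk τ' ≠ InfinitePlace.mk ι₁ → ((Matrix.diagonal dJ).map τ').PosDef)
    (K₀ : C5.OpenCompactSubgroup ↥(finAdelic ↥(maximalRealSubfield (F : Type)) (F : Type) (IsCMField.complexConj (F : Type)) 2 Jstar))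
    (S : RecordSystemGS (F : Type) Jstar ι₁ K₀) (hU7ₛ : S.HeckeTranslateDefinedOver) (hLQ : S.IsLevelQuotient)
    (h4 : 4 ≤ Module.finrank ℚ (F : Type)) (isoₛ : ℕ → Prop)
    (r : Rep ↥(maximalRealSubfield (F : Type)) (imagUnitSq F))
    (ε : Eps ↥(maximalRealSubfield (F : Type)) (imagUnitSq F))
    (_hadm : ∃ e : (F : Type), IsAdmissibleElement (F : Type) hμ.cmType.1 e ∧
      epsOf ↥(maximalRealSubfield (F : Type)) (imagUnitSq F) (F : Type) (2 * imagUnit (F : Type))⁻¹ (-e) = ε)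
    (χ : Chi ↥(maximalRealSubfield (F : Type)) (F : Type) (IsCMField.complexConj (F : Type))),
    letI : Algebra (F : Type) ℂ := ι₁.toAlgebra
    ∀ (K : C5.SmallLevel K₀) {B : Literature.AlgebraicGeometry.Motives.AbelianVariety (F : Type)} (φ : (sec42DataGS S h4 isoₛ).A K ⟶ B)
      (M : Type) [Field M] [NumberField M] [IsCMField M] (i : M →+* B.endAlgebra),
      Module.finrank ℚ M = 2 * B.dim →
      ∀ (τ : M →+* ℂ) (f : (AlgebraicClosure ℚ_[ℓ]) ⊗[ℚ_[ℓ]] Module.Dual ℚ_[ℓ] (B.rationalTateModule ℓ)),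
        (∀ m : M, ((AbelianVariety.rationalTateAction B ℓ (i m)).dualMap).baseChange (AlgebraicClosure ℚ_[ℓ]) f = ι' (τ m) • f) →
        (((sec42DataGS S h4 isoₛ).toTower ℓ K ∘ₗ (AbelianVariety.rationalTateModuleMap ℓ φ).dualMap).baseChange (AlgebraicClosure ℚ_[ℓ])) f ≠ 0 →
        (((sec42DataGS S h4 isoₛ).toTower ℓ K ∘ₗ (AbelianVariety.rationalTateModuleMap ℓ φ).dualMap).baseChange (AlgebraicClosure ℚ_[ℓ])) f ∈
          Submodule.span (AlgebraicClosure ℚ_[ℓ]) (blockValues (sec42DataGS S h4 isoₛ) ℓ (etaleHeckeDatumGS S hU7ₛ hLQ h4 isoₛ ℓ) ι'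
            ((rhoVAtLine ↥(maximalRealSubfield (F : Type)) (F : Type) (IsCMField.complexConj (F : Type)) 2
          (finProdFinEquiv : Fin 2 × Fin 1 ≃ Fin (2 * 1)) (Matrix.diagonal dJ)
          (complexConj_imagUnit F) (imagUnit_ne_zero F) (imagUnit_mul_self F) (realDiagonal_isSymm F dJ hdJ)
          (isUnit_det_realDiagonal F dJ hdJ hdJ0) (realDiagonal_map F dJ hdJ).symm
          (hsChiGS F finProdFinEquiv dJ hdJ hdJ0
            (toHeckeCharacter (F : Type) (galConj (IsCMField.complexConj (F : Type)) μ))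
            (isUnitary_toHeckeCharacter (F : Type) (galConj (IsCMField.complexConj (F : Type)) μ))
            ((isOscillatorChar_toHeckeCharacter_iff (galConj (IsCMField.complexConj (F : Type)) μ)).mpr hμ.galConj))
          (r.toFun ε) χ).comp
          (finAdelicCongr ↥(maximalRealSubfield (F : Type)) (F : Type) (IsCMField.complexConj (F : Type)) gstar ht hg).symm.toMonoidHom)) →
        ∀ (B' : Literature.AlgebraicGeometry.Motives.AbelianVariety (F : Type)) (u' : B ⟶ B') (v' : B' ⟶ B) (m : ℕ) (hm : 0 < m)
          (huv : u' ≫ v' = m • 𝟙 B) (hvu : v' ≫ u' = m • 𝟙 B') (ρ : 𝓞 M →+* End B')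
          (Φ : Literature.AlgebraicGeometry.Motives.CMType M),
          AbelianVariety.IsIsogeny u' →
          (∀ a : 𝓞 M, AbelianVariety.endAlgebraTransport u' v' m hm huv hvu (i (a : M)) = AbelianVariety.endAlgebra.of B' (ρ a)) →
          Literature.NumberTheory.ComplexMultiplication.IsCMTypeRealisationOver Φ B' ρ →
          (Literature.NumberTheory.ComplexMultiplication.cmInfinityType Φ.1 τ ι₁).1 (InfinitePlace.mk ι₁) =
            (1 - hμ.infinityType (InfinitePlace.mk ι₁)) / 2

/-- **`SocketS2` ⇐ S2′ + the (J2) conjunct**, by ONE call of ★ p739802 (`R := ℚ̄_ℓ`, `ι′.toRingHom`, `[Algebra F ℂ] := ι₁.toAlgebra`,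
`B := Im u`, `φ := ū`); `ψ_lab := χ τ`. -/
theorem socketS2_of_S2prime (hS2 : S2primeShape) (hJ2 : J2Shape) : SocketS2 := by
  intro F _ ι₁ μ hμ hw ℓ _ ι' Jstar t ht hτt hτt' gstar dJ hdJ hdJ0 hg hsig K₀ S hU7ₛ hLQ h4 isoₛ r ε hadm χ hne
  refine (hS2 F ι₁ μ hμ hw ℓ ι' Jstar t ht hτt hτt' gstar dJ hdJ hdJ0 hg hsig K₀ S hU7ₛ hLQ h4 isoₛ r ε hadm χ hne).elim
    fun K h => h.elim fun u h => h.elim fun a h => ?_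
  refine h.2.2.elim fun M h => h.elim fun _ h => h.elim fun _ h => h.elim fun _ h => h.elim fun i h => ?_
  have hdim := h.1
  refine h.2.elim fun τ h => h.elim fun f h => ?_
  have heig := h.1
  have hy0 := h.2.1
  have hyspan := h.2.2
  letI : Algebra (F : Type) ℂ := ι₁.toAlgebra
  refine ((sec42DataGS S h4 isoₛ).exists_heckeCharacter_towerRep_eq_inv_smul_of_ringHom' ℓ K (AbelianVariety.toImage u)
    i hdim).elim fun ψ h' => ?_
  have hcof := h'.2
  refine h'.1.elim fun B' h => h.elim fun u' h => h.elim fun v' h => h.elim fun m h => h.elim fun hm h =>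
    h.elim fun huv h => h.elim fun hvu h => h.elim fun ρ h => h.elim fun Φ h => ?_
  have hisog := h.1
  have hcompat := h.2.1
  have hreal := h.2.2.1
  have hinf := h.2.2.2
  have hp : (Literature.NumberTheory.ComplexMultiplication.cmInfinityType Φ.1 τ (algebraMap (F : Type) ℂ)).1
      (InfinitePlace.mk ι₁) = (1 - hμ.infinityType (InfinitePlace.mk ι₁)) / 2 :=
    hJ2 F ι₁ μ hμ hw ℓ ι' Jstar t ht hτt hτt' gstar dJ hdJ hdJ0 hg hsig K₀ S hU7ₛ hLQ h4 isoₛ r ε hadm χ K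
      (AbelianVariety.toImage u) M i hdim τ f heig hy0 hyspan B' u' v' m hm huv hvu ρ Φ hisog hcompat hreal
  refine ⟨ψ τ, ⟨_, _, hinf τ, hp⟩, _, hyspan, hy0, ?_⟩
  filter_upwards [hcof] with v hv hℓ 𝔓 h𝔓 σ hσ
  simpa only [RingEquiv.coe_toRingHom] using
    hv hℓ 𝔓 h𝔓 σ hσ (AlgebraicClosure ℚ_[ℓ]) (ι' : ℂ →+* AlgebraicClosure ℚ_[ℓ]) τ f
      (fun m' => by simpa only [RingEquiv.coe_toRingHom] using heig m')

/-- **THE HEAD, REGISTRATION FORM (WORLD M)**: the REGISTERED `thmD6OneCurveCUF` from S1′, S2′, the (J2) conjunct, and the two FACT texts S3/S4. -/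
theorem thmD6OneCurveCUF_M_of_S1_S2prime_J2_S3_S4 (h1 : SocketS1) (h2 : S2primeShape) (hJ2 : J2Shape) (h3 : S3ShapeM)
    (h4 : S4ShapeA) : thmD6OneCurveCUF :=
  thmD6OneCurveCUF_M_of_S1_S2_S3_S4 h1 (socketS2_of_S2prime h2 hJ2) h3 h4

/-! ## Part F — S1 clause (1) as a FACT SHAPE and the all-FACTS head -/

/-- **`S1Shape`** — S1 clause (1) = [Liu2021, Prop. D.4 (1)] «multiplicity at most one» at the registered `ω⋆_lab`, in the card՚s
«pairwise proportional» form: any two elements of `Hom(ι′ ∘ ω⋆_lab, ℚ̄_ℓ ⊗ H¹_ét(A_∞))` are `ℚ̄_ℓ`-proportional. -/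
def S1Shape : Prop :=
  ∀ (F : CMField) [IsGalois ℚ F] (ι₁ : F →+* ℂ)
    (μ : Literature.NumberTheory.Automorphic.IdeleClassGroup (F : Type) →ₜ* Circle)
    (hμ : IdeleClassGroup.IsConjugateSymplectic (F : Type) μ)
    (_hw : IdeleClassGroup.HasWeight (F : Type) μ 1)
    (ℓ : ℕ) [Fact ℓ.Prime] (ι' : ℂ ≃+* AlgebraicClosure ℚ_[ℓ])
    (Jstar : Matrix (Fin 2) (Fin 2) (F : Type)) (t : (F : Type)) (ht : t ≠ 0) (_hτt : 0 < (ι₁ t).re) (_hτt' : (ι₁ t).im = 0)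
    (gstar : GL (Fin 2) (F : Type))
    (dJ : Fin 2 → (F : Type)) (hdJ : ∀ i, IsCMField.complexConj (F : Type) (dJ i) = dJ i) (hdJ0 : ∀ i, dJ i ≠ 0)
    (hg : formCongr ((IsCMField.complexConj (F : Type) : (F : Type) ≃ₐ[↥(maximalRealSubfield (F : Type))] (F : Type)) :
        (F : Type) →+* (F : Type)) gstar (t • Jstar) = Matrix.diagonal dJ)
    (_hsig : (∃ Tstar : GL (Fin 2) ℂ,
        formCongr (starRingEnd ℂ) Tstar ((Matrix.diagonal dJ).map ι₁) = Matrix.diagonal ![(1 : ℂ), -1]) ∧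
      ∀ τ' : (F : Type) →+* ℂ, InfinitePlace.mk τ' ≠ InfinitePlace.mk ι₁ → ((Matrix.diagonal dJ).map τ').PosDef)
    (K₀ : C5.OpenCompactSubgroup ↥(finAdelic ↥(maximalRealSubfield (F : Type)) (F : Type) (IsCMField.complexConj (F : Type)) 2 Jstar))
    (S : RecordSystemGS (F : Type) Jstar ι₁ K₀) (hU7ₛ : S.HeckeTranslateDefinedOver) (hLQ : S.IsLevelQuotient)
    (h4 : 4 ≤ Module.finrank ℚ (F : Type)) (isoₛ : ℕ → Prop)
    (r : Rep ↥(maximalRealSubfield (F : Type)) (imagUnitSq F))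
    (ε : Eps ↥(maximalRealSubfield (F : Type)) (imagUnitSq F))
    (_hadm : ∃ e : (F : Type), IsAdmissibleElement (F : Type) hμ.cmType.1 e ∧
      epsOf ↥(maximalRealSubfield (F : Type)) (imagUnitSq F) (F : Type) (2 * imagUnit (F : Type))⁻¹ (-e) = ε)
    (χ : Chi ↥(maximalRealSubfield (F : Type)) (F : Type) (IsCMField.complexConj (F : Type))),
    ∀ f ∈ (etaleHeckeDatumGS S hU7ₛ hLQ h4 isoₛ ℓ).omegaHom ι'
        ((rhoVAtLine ↥(maximalRealSubfield (F : Type)) (F : Type) (IsCMField.complexConj (F : Type)) 2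
          (finProdFinEquiv : Fin 2 × Fin 1 ≃ Fin (2 * 1)) (Matrix.diagonal dJ)
          (complexConj_imagUnit F) (imagUnit_ne_zero F) (imagUnit_mul_self F) (realDiagonal_isSymm F dJ hdJ)
          (isUnit_det_realDiagonal F dJ hdJ hdJ0) (realDiagonal_map F dJ hdJ).symm
          (hsChiGS F finProdFinEquiv dJ hdJ hdJ0
            (toHeckeCharacter (F : Type) (galConj (IsCMField.complexConj (F : Type)) μ))
            (isUnitary_toHeckeCharacter (F : Type) (galConj (IsCMField.complexConj (F : Type)) μ))
            ((isOscillatorChar_toHeckeCharacter_iff (galConj (IsCMField.complexConj (F : Type)) μ)).mpr hμ.galConj))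
          (r.toFun ε) χ).comp
          (finAdelicCongr ↥(maximalRealSubfield (F : Type)) (F : Type) (IsCMField.complexConj (F : Type)) gstar ht hg).symm.toMonoidHom),
    ∀ g ∈ (etaleHeckeDatumGS S hU7ₛ hLQ h4 isoₛ ℓ).omegaHom ι'
        ((rhoVAtLine ↥(maximalRealSubfield (F : Type)) (F : Type) (IsCMField.complexConj (F : Type)) 2
          (finProdFinEquiv : Fin 2 × Fin 1 ≃ Fin (2 * 1)) (Matrix.diagonal dJ)
          (complexConj_imagUnit F) (imagUnit_ne_zero F) (imagUnit_mul_self F) (realDiagonal_isSymm F dJ hdJ)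
          (isUnit_det_realDiagonal F dJ hdJ hdJ0) (realDiagonal_map F dJ hdJ).symm
          (hsChiGS F finProdFinEquiv dJ hdJ hdJ0
            (toHeckeCharacter (F : Type) (galConj (IsCMField.complexConj (F : Type)) μ))
            (isUnitary_toHeckeCharacter (F : Type) (galConj (IsCMField.complexConj (F : Type)) μ))
            ((isOscillatorChar_toHeckeCharacter_iff (galConj (IsCMField.complexConj (F : Type)) μ)).mpr hμ.galConj))
          (r.toFun ε) χ).comp
          (finAdelicCongr ↥(maximalRealSubfield (F : Type)) (F : Type) (IsCMField.complexConj (F : Type)) gstar ht hg).symm.toMonoidHom),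
      ∃ a : (AlgebraicClosure ℚ_[ℓ]), g = a • f ∨ f = a • g

/-- `SocketS1` ⇐ `S1Shape` (★ `towerRep_comp_mem_omegaHom` inside `gs1_of_pairwise_proportional`). -/
theorem socketS1_of_S1Shape (h : S1Shape) : SocketS1 := by
  intro F _ ι₁ μ hμ hw ℓ _ ι' Jstar t ht hτt hτt' gstar dJ hdJ hdJ0 hg hsig K₀ S hU7ₛ hLQ h4 isoₛ r ε hadm χ
  exact gs1_of_pairwise_proportional _ _ _ _ _
    (h F ι₁ μ hμ hw ℓ ι' Jstar t ht hτt hτt' gstar dJ hdJ hdJ0 hg hsig K₀ S hU7ₛ hLQ h4 isoₛ r ε hadm χ)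

/-- **THE HEAD OVER THE FIVE TEXTS (WORLD M)**: the REGISTERED `thmD6OneCurveCUF` ⇐ S1 clause (1) FACT (`S1Shape`), S2′ THEOREM (`S2primeShape`),
the (J2) orientation conjunct (`J2Shape`), S3 FACT (`S3ShapeM`), S4 FACT (`S4ShapeA`) — everything else ★ and composed in this file. -/
theorem thmD6OneCurveCUF_M_of_facts (h1 : S1Shape) (h2 : S2primeShape) (hJ2 : J2Shape) (h3 : S3ShapeM) (h4 : S4ShapeA) :
    thmD6OneCurveCUF :=
  thmD6OneCurveCUF_M_of_S1_S2prime_J2_S3_S4 (socketS1_of_S1Shape h1) h2 hJ2 h3 h4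

end Summit.HodgeConjecture.CorCM.Lines.A3Liu418

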